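import Summits.CriticalPhenomena.PercolationContinuityZ3.Theorems.PercNearOneGluingAdditiveGluingTwoStepGlueBranch2
import HarnessLib

/-!
# Crux `PercNearOneGluing.AdditiveGluing` (stmt-CriticalPhenomena-4576): the slack-inheritance kernel (K₀)

Support file (`--supports stmt-CriticalPhenomena-4576`; task png-dp-al5, memos TWOSTEP-GLUE*.md, K0.md).  No definitions, no named
facts, no sorries.  Notation of `…TwoStepGlue*.lean`: pair `{a₁,a₂}` (to be glued) with `τ_{a₂} ≤ τ_{a₁}` (`τ_x = μ(x↔b)`), spectator `c`,
observer `o`, `N = {c↮a₁} ∩ {c↮a₂}`, `G_x = μ(x↮b, x↔{a₁,a₂}, {a₁,a₂}↔b)` (the pair is pivotal for `x↔b` = the exact gluing gain of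
`x`), `π = μ(a₁↔b ∪ a₂↔b) − τ_{a₂}` (the gluing gain of the weaker relay `a₂`; Kozma–Nitzan's Lemma 4 is `G_x ≤ π`), `σ_x = π − G_x`.

**(K₀)  `μ(N ∩ o↔c)·σ_c ≤ μ(N)·σ_o`**, i.e. `σ_o ≥ μ(o↔c | c↮{a₁,a₂})·σ_c`: the observer inherits at least the fraction
`φ_c = μ(o↔c | c↮{a₁,a₂})` of the spectator's Lemma-4 slack.  (K₀) is free of `t`, `θ` and rooms; numerically (task lab t38–t46:
> 12 000 general-position pair tests at `n ≤ 7`, adversarial climbs, all vertex coincidences) it has no violation and is tight exactly at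
`o ≡ c`.  This file shows that (K₀) closes the three-relay stub of the official skeleton: (K₀) ⟹ (II′) ⟹ CAG(3)
(`twoStep_cag3_of_k0`, via `twoStep_cag3_of_branch2`), the E-form (`twoStep_threeRelays_eform_of_k0`), and the registered stub
`stub_threeRelaysFullTieAllBad_pl` verbatim from the universally quantified (K₀) (`threeRelaysFullTieAllBad_of_k0`).
[cite: KozmaNitzan2024, Theorem 1 (pp. 7–8), Lemma 4 (p. 9), Question 7 (p. 36)]
-/

namespace Summit.CriticalPhenomena.PercolationContinuityZ3.Theorems

open MeasureTheory Set Literature.Probability.LatticeModels Literature.Probability.Percolation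

noncomputable section
open Classical

variable {n : ℕ}

/-- **CAG(3) from (K₀)**: for the pair `{a₁,a₂}` with `τ_{a₂} ≤ τ_{a₁}`, spectator `c`, `a₁ ≠ a₂`, `a₁ ≠ c` and `θ ≤ τ_{a₂}, τ_c`,
the slack-inheritance inequality (K₀) (file header) gives
`μ(o↔A, o↮b, A↔b) ≤ μ(A↔b) − θ` for `A = {a₁,a₂,c}`.  Proof: (K₀) and `μ(N ∩ o↔c) ≤ μ(N)`, `θ ≤ τ_{a₂}`, `θ ≤ τ_c`, `ROOM₂ ≥ 0`
give (II′), and `twoStep_cag3_of_branch2` concludes.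
[cite: KozmaNitzan2024, Theorem 1 (pp. 7–8), Lemma 4 (p. 9), Question 7 (p. 36)] -/
theorem twoStep_cag3_of_k0 (w : Sym2 (Fin n) → unitInterval) (o b a₁ a₂ c : Fin n) (h12 : a₁ ≠ a₂) (h1c : a₁ ≠ c)
    (θ : ℝ) (hθ2 : θ ≤ (prodBernoulli w).real (openConn a₂ b))
    (h21 : (prodBernoulli w).real (openConn a₂ b) ≤ (prodBernoulli w).real (openConn a₁ b))
    (hθc : θ ≤ (prodBernoulli w).real (openConn c b))
    (hK : (prodBernoulli w).real ((openConn c a₁)ᶜ ∩ (openConn c a₂)ᶜ ∩ openConn o c) *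
        ((prodBernoulli w).real (openConn a₁ b ∪ openConn a₂ b) - (prodBernoulli w).real (openConn a₂ b) -
          (prodBernoulli w).real ((openConn c b)ᶜ ∩ (openConn c a₁ ∪ openConn c a₂) ∩ (openConn a₁ b ∪ openConn a₂ b))) ≤
      (prodBernoulli w).real ((openConn c a₁)ᶜ ∩ (openConn c a₂)ᶜ : Set (BondConfig (Fin n))) *
        ((prodBernoulli w).real (openConn a₁ b ∪ openConn a₂ b) - (prodBernoulli w).real (openConn a₂ b) -
          (prodBernoulli w).real ((openConn o b)ᶜ ∩ (openConn o a₁ ∪ openConn o a₂) ∩ (openConn a₁ b ∪ openConn a₂ b)))) :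
    (prodBernoulli w).real ((openConn o a₁ ∪ openConn o a₂ ∪ openConn o c) ∩ (openConn o b)ᶜ ∩
        (openConn a₁ b ∪ openConn a₂ b ∪ openConn c b)) ≤
      (prodBernoulli w).real (openConn a₁ b ∪ openConn a₂ b ∪ openConn c b) - θ := by
  refine twoStep_cag3_of_branch2 w o b a₁ a₂ c h12 h1c θ (hθ2.trans h21) hθ2 ?_
  have hψ : (prodBernoulli w).real ((openConn c a₁)ᶜ ∩ (openConn c a₂)ᶜ ∩ openConn o c) ≤
      (prodBernoulli w).real ((openConn c a₁)ᶜ ∩ (openConn c a₂)ᶜ : Set (BondConfig (Fin n))) :=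
    measureReal_mono Set.inter_subset_left (measure_ne_top _ _)
  have hψ0 : 0 ≤ (prodBernoulli w).real ((openConn c a₁)ᶜ ∩ (openConn c a₂)ᶜ ∩ openConn o c) := measureReal_nonneg
  have hR2 : 0 ≤ (prodBernoulli w).real ((openConn o a₁ ∪ openConn o a₂ ∪ openConn o c)ᶜ ∩ openConn c b ∩
      (openConn a₁ b ∪ openConn a₂ b)ᶜ) := measureReal_nonneg
  have hN0 : 0 ≤ (prodBernoulli w).real ((openConn c a₁)ᶜ ∩ (openConn c a₂)ᶜ : Set (BondConfig (Fin n))) := measureReal_nonneg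
  have h1 := mul_le_mul_of_nonneg_right hψ (sub_nonneg.2 hθ2)
  have h2 : (prodBernoulli w).real ((openConn c a₁)ᶜ ∩ (openConn c a₂)ᶜ ∩ openConn o c) *
      ((prodBernoulli w).real (openConn a₁ b ∪ openConn a₂ b) - (prodBernoulli w).real (openConn c b) -
        (prodBernoulli w).real ((openConn c b)ᶜ ∩ (openConn c a₁ ∪ openConn c a₂) ∩ (openConn a₁ b ∪ openConn a₂ b))) ≤
      (prodBernoulli w).real ((openConn c a₁)ᶜ ∩ (openConn c a₂)ᶜ ∩ openConn o c) *
      ((prodBernoulli w).real (openConn a₁ b ∪ openConn a₂ b) - θ -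
        (prodBernoulli w).real ((openConn c b)ᶜ ∩ (openConn c a₁ ∪ openConn c a₂) ∩ (openConn a₁ b ∪ openConn a₂ b))) :=
    mul_le_mul_of_nonneg_left (by linarith) hψ0
  have h3 := mul_nonneg hN0 hR2
  nlinarith [hK, h1, h2, h3]

/-- **E-form corollary of (K₀)**: three relays, pair `{a₁,a₂}` with `τ_{a₂} ≤ τ_{a₁}`, spectator `a₃`, `1 − t ≤ τ_{a₂}, τ_{a₃}`;
(K₀) gives `μ((o↔a₁ ∪ o↔a₂ ∪ o↔a₃) \ o↔b) ≤ t`. [cite: KozmaNitzan2024, Question 7 (p. 36), Lemma 4 (p. 9)] -/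
theorem twoStep_threeRelays_eform_of_k0 (w : Sym2 (Fin n) → unitInterval) (o b a₁ a₂ a₃ : Fin n) (t : ℝ)
    (h12 : a₁ ≠ a₂) (h13 : a₁ ≠ a₃)
    (ht2 : 1 - t ≤ (prodBernoulli w).real (openConn a₂ b))
    (h21 : (prodBernoulli w).real (openConn a₂ b) ≤ (prodBernoulli w).real (openConn a₁ b))
    (ht3 : 1 - t ≤ (prodBernoulli w).real (openConn a₃ b))
    (hK : (prodBernoulli w).real ((openConn a₃ a₁)ᶜ ∩ (openConn a₃ a₂)ᶜ ∩ openConn o a₃) *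
        ((prodBernoulli w).real (openConn a₁ b ∪ openConn a₂ b) - (prodBernoulli w).real (openConn a₂ b) -
          (prodBernoulli w).real ((openConn a₃ b)ᶜ ∩ (openConn a₃ a₁ ∪ openConn a₃ a₂) ∩ (openConn a₁ b ∪ openConn a₂ b))) ≤
      (prodBernoulli w).real ((openConn a₃ a₁)ᶜ ∩ (openConn a₃ a₂)ᶜ : Set (BondConfig (Fin n))) *
        ((prodBernoulli w).real (openConn a₁ b ∪ openConn a₂ b) - (prodBernoulli w).real (openConn a₂ b) -
          (prodBernoulli w).real ((openConn o b)ᶜ ∩ (openConn o a₁ ∪ openConn o a₂) ∩ (openConn a₁ b ∪ openConn a₂ b)))) :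
    (prodBernoulli w).real ((openConn o a₁ ∪ openConn o a₂ ∪ openConn o a₃) \ openConn o b) ≤ t := by
  have hcag := twoStep_cag3_of_k0 w o b a₁ a₂ a₃ h12 h13 (1 - t) ht2 h21 ht3 hK
  have hm : ∀ s : Set (BondConfig (Fin n)), MeasurableSet s := fun _ => MeasurableSet.of_discrete
  set μ := prodBernoulli w with hμ
  set oA : Set (BondConfig (Fin n)) := openConn o a₁ ∪ openConn o a₂ ∪ openConn o a₃ with hoA
  set Ab : Set (BondConfig (Fin n)) := openConn a₁ b ∪ openConn a₂ b ∪ openConn a₃ b with hAb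
  have h1 := measureReal_inter_add_sdiff (μ := μ) (s := oA \ openConn o b) (hm Ab)
  have e1 : (oA \ openConn o b) ∩ Ab = oA ∩ (openConn o b)ᶜ ∩ Ab := by rw [Set.sdiff_eq]
  have h2 : μ.real ((oA \ openConn o b) \ Ab) ≤ μ.real Abᶜ := measureReal_mono (fun ω hω => hω.2) (measure_ne_top _ _)
  have h3 : μ.real Abᶜ = 1 - μ.real Ab := probReal_compl_eq_one_sub (hm _)
  rw [e1] at h1
  linarith

end

/-- **(K₀) ⟹ `stub_threeRelaysFullTieAllBad_pl`** (the latter verbatim; of its hypotheses only `a₁ ≠ a₂`, `a₁ ≠ a₃`, `1 − t ≤ τ₃`,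
`τ₃ ≤ τ₁` and `τ₂ ≤ τ₃` are used — at the full tie the pair `{a₁,a₂}` is ordered either way).  The hypothesis is (K₀) universally
quantified, in the ordered form `τ_{a₂} ≤ τ_{a₁}` (registered as `stub_k0_dp`). [cite: KozmaNitzan2024, Question 7 (p. 36), Lemma 4 (p. 9)] -/
theorem threeRelaysFullTieAllBad_of_k0
    (hK0 : ∀ (n : ℕ) (w : Sym2 (Fin n) → unitInterval) (o b a₁ a₂ c : Fin n), (Literature.Probability.LatticeModels.prodBernoulli w).real (Literature.Probability.Percolation.openConn a₂ b) ≤ (Literature.Probability.LatticeModels.prodBernoulli w).real (Literature.Probability.Percolation.openConn a₁ b) → (Literature.Probability.LatticeModels.prodBernoulli w).real ((Literature.Probability.Percolation.openConn c a₁)ᶜ ∩ (Literature.Probability.Percolation.openConn c a₂)ᶜ ∩ Literature.Probability.Percolation.openConn o c) * ((Literature.Probability.LatticeModels.prodBernoulli w).real (Literature.Probability.Percolation.openConn a₁ b ∪ Literature.Probability.Percolation.openConn a₂ b) - (Literature.Probability.LatticeModels.prodBernoulli w).real (Literature.Probability.Percolation.openConn a₂ b) - (Literature.Probability.LatticeModels.prodBernoulli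 w).real ((Literature.Probability.Percolation.openConn c b)ᶜ ∩ (Literature.Probability.Percolation.openConn c a₁ ∪ Literature.Probability.Percolation.openConn c a₂) ∩ (Literature.Probability.Percolation.openConn a₁ b ∪ Literature.Probability.Percolation.openConn a₂ b))) ≤ (Literature.Probability.LatticeModels.prodBernoulli w).real ((Literature.Probability.Percolation.openConn c a₁)ᶜ ∩ (Literature.Probability.Percolation.openConn c a₂)ᶜ : Set (Literature.Probability.Percolation.BondConfig (Fin n))) * ((Literature.Probability.LatticeModels.prodBernoulli w).real (Literature.Probability.Percolation.openConn a₁ b ∪ Literature.Probability.Percolation.openConn a₂ b) - (Literature.Probability.LatticeModels.prodBernoulli w).real (Literature.Probability.Percolation.openConn a₂ b) - (Literature.Probability.LatticeModels.prodBernoulli w).real ((Literature.Probability.Percolation.openConn o b)ᶜ ∩ (Literature.Probability.Percolation.openConn o a₁ ∪ Literature.Probability.Percolation.openConn o a₂) ∩ (Literature.Probability.Percolation.openConn a₁ b ∪ Literature.Probability.Percolation.openConn a₂ b)))) :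
    ∀ (n : ℕ) (w : Sym2 (Fin n) → unitInterval) (o b a₁ a₂ a₃ : Fin n) (t : ℝ), a₁ ≠ a₂ → a₁ ≠ a₃ → a₂ ≠ a₃ → 1 - t ≤ (prodBernoulli w).real (openConn a₃ b) → (prodBernoulli w).real (openConn a₃ b) ≤ (prodBernoulli w).real (openConn a₁ b) → (prodBernoulli w).real (openConn a₃ b) ≤ (prodBernoulli w).real (openConn a₂ b) → (prodBernoulli w).real (openConn a₁ b) ≤ (prodBernoulli w).real (openConn a₃ b) → (prodBernoulli w).real (openConn a₂ b) ≤ (prodBernoulli w).real (openConn a₃ b) → 0 < (prodBernoulli w).real ((openConn a₁ a₂)ᶜ ∩ (openConn a₁ a₃)ᶜ : Set (BondConfig (Fin n))) → 0 < (prodBernoulli w).real ((openConn a₂ a₁)ᶜ ∩ (openConn a₂ a₃)ᶜ : Set (BondConfig (Fin n))) → 0 < (prodBernoulli w).real ((openConn a₁ a₃)ᶜ ∩ (openConn a₂ a₃)ᶜ : Set (BondConfig (Fin n))) → (prodBernoulli w).real (openConn b a₂ ∩ openConn b a₃ ∩ (openConn b a₁)ᶜ) < (prodBernoulli w).real (openConn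 b a₁ ∩ (openConn b a₂)ᶜ ∩ (openConn b a₃)ᶜ) → (prodBernoulli w).real (openConn b a₁ ∩ openConn b a₃ ∩ (openConn b a₂)ᶜ) < (prodBernoulli w).real (openConn b a₂ ∩ (openConn b a₁)ᶜ ∩ (openConn b a₃)ᶜ) → (prodBernoulli w).real (openConn b a₁ ∩ openConn b a₂ ∩ (openConn b a₃)ᶜ) < (prodBernoulli w).real (openConn b a₃ ∩ (openConn b a₁)ᶜ ∩ (openConn b a₂)ᶜ) → (prodBernoulli w).real ((openConn o a₁ ∪ openConn o a₂ ∪ openConn o a₃) \ openConn o b) ≤ t := by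
  intro n w o b a₁ a₂ a₃ t h12 h13 _ ht3 h31 h32 _ h23 _ _ _ _ _ _
  exact twoStep_threeRelays_eform_of_k0 w o b a₁ a₂ a₃ t h12 h13 (ht3.trans h32) (h23.trans h31) ht3
    (hK0 n w o b a₁ a₂ a₃ (h23.trans h31))

end Summit.CriticalPhenomena.PercolationContinuityZ3.Theorems
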